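import Summits.HodgeConjecture.CorCM.Census.CentralSquaresPairFaceCover

/-!
# The square-central class, XXVI: the MIXED designated face at `m = 2` — the `T₁`-defect of `Φ = {T ∣ A}` and the stabiliser relation

COR-CM (cell `pub-hodgecm2`), count-neutral kernel combinatorics by the binder seat b09 (gen 46; lane SQUARE-CENTRAL CLASS, part XXVI), on parts XIV
(`single_sub_thetaG_mem_mixed_pair`, `single_sub_thetaG_mem_tie_corner` — the FORCING forms, no dichotomy), V/VI/VII (frame exchange:
`base_cases_exchange`, `card_frame`, `card_sdiff_frame`, `cover_frame`, `sdiff_eq_of_dev`), II (`dev_compl`) and gen 31ʼs `mapDomain_rt_thetaG`, BY NAME.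
Theorems only: no definition, no `decide`, no certificate, no named fact, no `sorry`.  HONEST FRAMING: `HC_CM` is NOT proved, here or anywhere in the tree;
nothing here is a period or a headline.

THE ORDER-`4` SWAP ROWS (`ℤ/4 ⋊ ℤ/4`, `c = a²` or `a²y²`; design note `CENTRAL-SQUARES-M2.md` §5).  In the four-type frame at `m = 2` (`|T₀| = 8`, `𝓗 = T₀ ∖ T₁`
of size `4`) take `T ⊆ 𝓗` and `A ⊆ 𝓗ᶜ = T₀ ∩ T₁` of size `2` each, `𝓗 ∖ T = {h, h''}`, `𝓗ᶜ ∖ A = {k', k'''}`, `A = {k, k''}`, and the level-`4` type `Φ`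
with `D(Φ) = T ∪ A` (a four-way tie, part XXI `ddist_pair_type`).  The DESIGNATED FACE is the MIXED face of `Φ` at the places of `k ∈ A` and `h ∈ 𝓗 ∖ T`
(lowering toward `T₁`: `D_{T₁}(Φ) = c·(𝓗 ∖ T) ∪ A`); its corners are the mixed pair `Φ^{(k)(h)}` (unique nearest base change `T₁`), the `T₁/T₀` tie
`Φ^{(k)}` and the `T̄₀/T₁` tie `Φ^{(h)}`.  Numerically (all ten random strict covers of `lean-g46/py/z4z4seeds.py`) the closure FAILS when the strict cover
resolves both ties toward `T₀`, `T̄₀`; so the successor PRESCRIBES the strict faces at the two tie blocks as well (admissible: part XIIIʼs choice `τ` is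
free at blocks with strict triples), namely the face of `Φ^{(k)}` with places `h, h''` (strict toward `T₁`) and the face of `Φ^{(h)}` with places `k', k'''`
(strict toward `T̄₀`).  With these three faces in the base-change stable lattice `L ⊇ ℤ⟨pairs⟩` of a strict lowering cover:

* §1 `sdiff_T₁_pair_type` (`D_{T₁}(Φ) = A ∪ c·(𝓗 ∖ T)`), `dev_compl_oflipCM_pair_type` (`D_{T₀}(c·Φ^{(h)}) = {h'', k', k'''}`).
* §2 **`defect_T₁_mixed_face`**: `[Φ] − θ_{T₁}(typeSum [Φ]) − (θ_{T̄₀} − θ_{T₁})(typeSum [Φ^{(h)}]) ∈ L` — the `T₁`-star defect of `Φ` is the near vector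
  `(θ_{T̄₀} − θ_{T₁})(typeSum [Φ^{(h)}])` (in coordinates `−Y_{h''} − Rᶜ(𝓗ᶜ ∖ A)`, part XXVII); proof: the face identity, `typeSum (face) = 0`, and the
  three corner normal forms (part XIV in the frames `(T₁; T₀)` and — through the complement `c·Φ^{(h)}`, a shape-A corner — `(T₀; T₁)`).
* §3 **`mixed_face_stabiliser_relation`**: for `g₁` with `T₀·g₁⁻¹ = T₀`, `T₁·g₁⁻¹ = T̄₁`, `Φ·g₁⁻¹ = Φ` (in the rows: a lift of `sr`, `g₁² = z`,
  `Stab Φ = ⟨g₁⟩`): `(θ_{T̄₁} − θ_{T₁})(typeSum [Φ]) − (θ_{T̄₀} − θ_{T₁})(typeSum [Φ^{(h)}]) + (θ_{T̄₀} − θ_{T̄₁})(typeSum [Φ^{(h·g₁⁻¹)}]) ∈ L` — the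
  ONE new near relation `W` of the order-`4` rows (`= Y_h‑type − Y'_{τh}‑type` in coordinates; its translates close the residual lattice up to `4`).

## References
* [Pohlmann1968] H. Pohlmann, Algebraic cycles on abelian varieties of complex multiplication type, Ann. of Math. 88 (1968), Thm 1.
* [Milne1999] J. S. Milne, Lefschetz motives and the Tate conjecture, Compositio Math. 117 (1999), Prop. 2.1, p. 54.
-/

namespace Summit.HodgeConjecture.CorCM.Census.CentralSquares

open Finset
open scoped symmDiff
open Summit.HodgeConjecture.CorCM.Prior.AllgGroup.RfwfAllgGroup
open Summit.HodgeConjecture.CorCM.Census.BlockParity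
open Summit.HodgeConjecture.CorCM.Census.Coinvariant
open Summit.HodgeConjecture.CorCM.Census.TwistGeneration
open Summit.HodgeConjecture.CorCM.Census.BaseBlock
open Summit.HodgeConjecture.CorCM.Census.CoverClosure

noncomputable section

variable {G : Type*} [Group G] [Fintype G] [DecidableEq G] (c : G)

section Frame

variable (hc2 : c * c = 1) (hcen : ∀ x : G, x * c = c * x) (T₀ T₁ : CMF G c)
variable (hbase : ∀ Q : G, rt c Q T₀ = T₀ ∨ rt c Q T₀ = rt c c T₀ ∨ rt c Q T₀ = T₁ ∨ rt c Q T₀ = rt c c T₁)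
variable (m : ℕ) (hn : T₀.1.card = 4 * m) (hH : (T₀.1 \ T₁.1).card = 2 * m)
variable (Q : G) (hQ : rt c Q T₀ = T₁)
variable (L : Submodule ℤ (CMF G c →₀ ℤ)) (hLrt : ∀ (Q' : G) (y : CMF G c →₀ ℤ), y ∈ L → Finsupp.mapDomain (rt c Q') y ∈ L)
variable (hcover : ∀ Ψ : CMF G c, 2 ≤ bpot c T₀ Ψ → ∃ Q₂ s s' : G, bpot c T₀ Ψ = ddist (rt c Q₂ T₀) Ψ ∧
    s ∈ (rt c Q₂ T₀).1 \ Ψ.1 ∧ s' ∈ (rt c Q₂ T₀).1 \ Ψ.1 ∧ s ≠ s' ∧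
    gface c hc2 Ψ s s' ∈ L ∧
    ((∃ Q₁ t t' : G, bpot c T₀ Ψ = ddist (rt c Q₁ T₀) Ψ ∧ t ∈ (rt c Q₁ T₀).1 \ Ψ.1 ∧ t' ∈ (rt c Q₁ T₀).1 \ Ψ.1 ∧ t ≠ t' ∧
        (∀ Q' : G, ddist (rt c Q' T₀) (oflipCM c hc2 t Ψ) = bpot c T₀ (oflipCM c hc2 t Ψ) → rt c Q' T₀ = rt c Q₁ T₀) ∧
        (∀ Q' : G, ddist (rt c Q' T₀) (oflipCM c hc2 t' Ψ) = bpot c T₀ (oflipCM c hc2 t' Ψ) → rt c Q' T₀ = rt c Q₁ T₀) ∧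
        (∀ Q' : G, ddist (rt c Q' T₀) (oflipCM c hc2 t (oflipCM c hc2 t' Ψ)) = bpot c T₀ (oflipCM c hc2 t (oflipCM c hc2 t' Ψ)) →
          rt c Q' T₀ = rt c Q₁ T₀)) →
      (∀ Q' : G, ddist (rt c Q' T₀) (oflipCM c hc2 s Ψ) = bpot c T₀ (oflipCM c hc2 s Ψ) → rt c Q' T₀ = rt c Q₂ T₀) ∧
      (∀ Q' : G, ddist (rt c Q' T₀) (oflipCM c hc2 s' Ψ) = bpot c T₀ (oflipCM c hc2 s' Ψ) → rt c Q' T₀ = rt c Q₂ T₀) ∧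
      (∀ Q' : G, ddist (rt c Q' T₀) (oflipCM c hc2 s (oflipCM c hc2 s' Ψ)) = bpot c T₀ (oflipCM c hc2 s (oflipCM c hc2 s' Ψ)) →
        rt c Q' T₀ = rt c Q₂ T₀)))

/-! ## §1 Deviation sets of the designated type and of its corners -/

include hc2 in
/-- **`D_{T₁}(Φ) = A ∪ c·(𝓗 ∖ T)`** for the type `Φ` with `D_{T₀}(Φ) = T ∪ A`, `T ⊆ 𝓗`, `A ⊆ T₀ ∩ T₁`. [folklore] -/
theorem sdiff_T₁_pair_type (T A : Finset G) (hTH : T ⊆ T₀.1 \ T₁.1) (hA : A ⊆ T₀.1 ∩ T₁.1) (Φ : CMF G c) (hΦ : T₀.1 \ Φ.1 = T ∪ A) :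
    T₁.1 \ Φ.1 = A ∪ ((T₀.1 \ T₁.1) \ T).image (fun t => c * t) := by
  have hAH : ∀ a ∈ A, a ∉ T₀.1 \ T₁.1 := fun a ha h => (mem_sdiff.mp h).2 (mem_inter.mp (hA ha)).2
  have h1 : (T ∪ A) \ (T₀.1 \ T₁.1) = A := by
    ext x; simp only [mem_sdiff, mem_union]
    constructor
    · rintro ⟨hx | hx, hx'⟩
      · exact absurd (mem_sdiff.mp (hTH hx)) hx'
      · exact hx
    · intro hx; exact ⟨Or.inr hx, fun h => hAH x hx (mem_sdiff.mpr h)⟩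
  have h2 : (T₀.1 \ T₁.1) \ (T ∪ A) = (T₀.1 \ T₁.1) \ T := by
    ext x; simp only [mem_sdiff, mem_union, not_or]
    constructor
    · rintro ⟨hx, hxT, -⟩; exact ⟨hx, hxT⟩
    · rintro ⟨hx, hxT⟩; exact ⟨hx, hxT, fun hxA => hAH x hxA (mem_sdiff.mpr hx)⟩
  rw [sdiff_eq_of_dev c hc2 T₀ T₁ Φ, hΦ, h1, h2]

include hc2 hcen in
/-- **`D_{T₀}(c·Φ^{(h)}) = {h''} ∪ (𝓗ᶜ ∖ A)`**: the complement of the corner `Φ^{(h)}` (`h ∈ 𝓗 ∖ T` flipped into the deviation set) deviates from `T₀`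
exactly at the other place `h''` of `𝓗 ∖ T` and on `𝓗ᶜ ∖ A`. [folklore] -/
theorem dev_compl_oflipCM_pair_type (T A : Finset G) (hTH : T ⊆ T₀.1 \ T₁.1) (hA : A ⊆ T₀.1 ∩ T₁.1) (Φ : CMF G c)
    (hΦ : T₀.1 \ Φ.1 = T ∪ A) {h h'' : G} (hHe : (T₀.1 \ T₁.1) \ T = {h, h''}) (hhh'' : h ≠ h'')
    {k' k''' : G} (hAce : (T₀.1 ∩ T₁.1) \ A = {k', k'''}) :
    T₀.1 \ (rt c c (oflipCM c hc2 h Φ)).1 = {h'', k', k'''} := by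
  have hh : h ∈ (T₀.1 \ T₁.1) \ T := by rw [hHe]; exact mem_insert_self _ _
  have hh0 : h ∈ T₀.1 := (mem_sdiff.mp (mem_sdiff.mp hh).1).1
  have hhΦ : h ∈ Φ.1 := by
    by_contra hc
    have : h ∈ T₀.1 \ Φ.1 := mem_sdiff.mpr ⟨hh0, hc⟩
    rw [hΦ, mem_union] at this
    rcases this with hT | hAm
    · exact (mem_sdiff.mp hh).2 hT
    · exact (mem_sdiff.mp (mem_sdiff.mp hh).1).2 (mem_inter.mp (hA hAm)).2
  rw [dev_compl c hcen, dev_oflip_of_mem c hc2 hh0 hhΦ, hΦ]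
  ext x
  simp only [mem_sdiff, mem_insert, mem_union, mem_singleton, not_or]
  constructor
  · rintro ⟨hx0, hxh, hxT, hxA⟩
    by_cases hx1 : x ∈ T₁.1
    · have hx : x ∈ (T₀.1 ∩ T₁.1) \ A := mem_sdiff.mpr ⟨mem_inter.mpr ⟨hx0, hx1⟩, hxA⟩
      rw [hAce, mem_insert, mem_singleton] at hx
      exact Or.inr hx
    · have hx : x ∈ (T₀.1 \ T₁.1) \ T := mem_sdiff.mpr ⟨mem_sdiff.mpr ⟨hx0, hx1⟩, hxT⟩
      rw [hHe, mem_insert, mem_singleton] at hx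
      rcases hx with hx | hx
      · exact absurd hx hxh
      · exact Or.inl hx
  · rintro (rfl | rfl | rfl)
    · have hx : x ∈ (T₀.1 \ T₁.1) \ T := by rw [hHe]; exact mem_insert_of_mem (mem_singleton_self _)
      obtain ⟨hxH, hxT⟩ := mem_sdiff.mp hx
      exact ⟨(mem_sdiff.mp hxH).1, hhh''.symm, hxT, fun hxA => (mem_sdiff.mp hxH).2 (mem_inter.mp (hA hxA)).2⟩
    · have hx : x ∈ (T₀.1 ∩ T₁.1) \ A := by rw [hAce]; exact mem_insert_self _ _
      obtain ⟨hxI, hxA⟩ := mem_sdiff.mp hx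
      refine ⟨(mem_inter.mp hxI).1, ?_, fun hxT => (mem_sdiff.mp (hTH hxT)).2 (mem_inter.mp hxI).2, hxA⟩
      rintro rfl; exact (mem_sdiff.mp (mem_sdiff.mp hh).1).2 (mem_inter.mp hxI).2
    · have hx : x ∈ (T₀.1 ∩ T₁.1) \ A := by rw [hAce]; exact mem_insert_of_mem (mem_singleton_self _)
      obtain ⟨hxI, hxA⟩ := mem_sdiff.mp hx
      refine ⟨(mem_inter.mp hxI).1, ?_, fun hxT => (mem_sdiff.mp (hTH hxT)).2 (mem_inter.mp hxI).2, hxA⟩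
      rintro rfl; exact (mem_sdiff.mp (mem_sdiff.mp hh).1).2 (mem_inter.mp hxI).2

/-! ## §2 The `T₁`-defect of the designated type from its mixed face and the two prescribed strict faces -/

include hcen hbase hn hH hQ hLrt hcover in
/-- **THE `T₁`-DEFECT OF THE DESIGNATED TYPE** (`m = 2`).  `D(Φ) = T ∪ A` (`T ⊆ 𝓗`, `A = {k, k''} ⊆ 𝓗ᶜ`, both of size `2`), `𝓗 ∖ T = {h, h''}`,
`𝓗ᶜ ∖ A = {k', k'''}`.  If `L` (base-change stable, fed by a strict lowering cover) contains the mixed face of `Φ` at the places of `k, h`, the face of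
`Φ^{(k)}` at the places of `h, h''` and the face of `Φ^{(h)}` at the places of `k', k'''`, then
`[Φ] − θ_{T₁}(typeSum [Φ]) − (θ_{T̄₀}(typeSum [Φ^{(h)}]) − θ_{T₁}(typeSum [Φ^{(h)}])) ∈ L`. [folklore] -/
theorem defect_T₁_mixed_face (hm : m = 2) (T A : Finset G) (hTH : T ⊆ T₀.1 \ T₁.1) (hA : A ⊆ T₀.1 ∩ T₁.1)
    (Φ : CMF G c) (hΦ : T₀.1 \ Φ.1 = T ∪ A)
    {k k'' : G} (hAe : A = {k, k''}) (hkk'' : k ≠ k'')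
    {h h'' : G} (hHe : (T₀.1 \ T₁.1) \ T = {h, h''}) (hhh'' : h ≠ h'')
    {k' k''' : G} (hAce : (T₀.1 ∩ T₁.1) \ A = {k', k'''}) (hk'k''' : k' ≠ k''')
    (hF : gface c hc2 Φ k h ∈ L) (hFk : gface c hc2 (oflipCM c hc2 k Φ) h h'' ∈ L)
    (hFh : gface c hc2 (oflipCM c hc2 h Φ) k' k''' ∈ L) :
    Finsupp.single Φ 1 - thetaG c hc2 T₁ (typeSum G c (Finsupp.single Φ 1)) -
      (thetaG c hc2 (rt c c T₀) (typeSum G c (Finsupp.single (oflipCM c hc2 h Φ) 1)) -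
        thetaG c hc2 T₁ (typeSum G c (Finsupp.single (oflipCM c hc2 h Φ) 1))) ∈ L := by
  have hm2 : 2 ≤ m := by omega
  -- the elements
  have hk : k ∈ A := by rw [hAe]; exact mem_insert_self _ _
  have hk'' : k'' ∈ A := by rw [hAe]; exact mem_insert_of_mem (mem_singleton_self _)
  have hk0 : k ∈ T₀.1 := (mem_inter.mp (hA hk)).1
  have hk1 : k ∈ T₁.1 := (mem_inter.mp (hA hk)).2
  have hk''0 : k'' ∈ T₀.1 := (mem_inter.mp (hA hk'')).1
  have hk''1 : k'' ∈ T₁.1 := (mem_inter.mp (hA hk'')).2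
  have hkΦ : k ∉ Φ.1 := by
    have h0 : k ∈ T₀.1 \ Φ.1 := by rw [hΦ]; exact mem_union_right _ hk
    exact (mem_sdiff.mp h0).2
  have hh : h ∈ (T₀.1 \ T₁.1) \ T := by rw [hHe]; exact mem_insert_self _ _
  have hh'' : h'' ∈ (T₀.1 \ T₁.1) \ T := by rw [hHe]; exact mem_insert_of_mem (mem_singleton_self _)
  have hh0 : h ∈ T₀.1 := (mem_sdiff.mp (mem_sdiff.mp hh).1).1
  have hh1 : h ∉ T₁.1 := (mem_sdiff.mp (mem_sdiff.mp hh).1).2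
  have hh''0 : h'' ∈ T₀.1 := (mem_sdiff.mp (mem_sdiff.mp hh'').1).1
  have hh''1 : h'' ∉ T₁.1 := (mem_sdiff.mp (mem_sdiff.mp hh'').1).2
  have hch1 : c * h ∈ T₁.1 := by by_contra hc'; exact hh1 ((T₁.2 h).mpr hc')
  have hch''1 : c * h'' ∈ T₁.1 := by by_contra hc'; exact hh''1 ((T₁.2 h'').mpr hc')
  have hch0 : c * h ∉ T₀.1 := (T₀.2 h).mp hh0
  have hch''0 : c * h'' ∉ T₀.1 := (T₀.2 h'').mp hh''0
  have hhΦ : h ∈ Φ.1 := by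
    by_contra hc'
    have h0 : h ∈ T₀.1 \ Φ.1 := mem_sdiff.mpr ⟨hh0, hc'⟩
    rw [hΦ, mem_union] at h0
    rcases h0 with hT | hAm
    · exact (mem_sdiff.mp hh).2 hT
    · exact hh1 (mem_inter.mp (hA hAm)).2
  have hchΦ : c * h ∉ Φ.1 := (Φ.2 h).mp hhΦ
  have hk' : k' ∈ (T₀.1 ∩ T₁.1) \ A := by rw [hAce]; exact mem_insert_self _ _
  have hk''' : k''' ∈ (T₀.1 ∩ T₁.1) \ A := by rw [hAce]; exact mem_insert_of_mem (mem_singleton_self _)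
  have hk'0 : k' ∈ T₀.1 := (mem_inter.mp (mem_sdiff.mp hk').1).1
  have hk'1 : k' ∈ T₁.1 := (mem_inter.mp (mem_sdiff.mp hk').1).2
  have hk'''0 : k''' ∈ T₀.1 := (mem_inter.mp (mem_sdiff.mp hk''').1).1
  have hk'''1 : k''' ∈ T₁.1 := (mem_inter.mp (mem_sdiff.mp hk''').1).2
  have hkch : k ≠ c * h := fun e => hch0 (e ▸ hk0)
  have hkch'' : k ≠ c * h'' := fun e => hch''0 (e ▸ hk0)
  have hk''ch'' : k'' ≠ c * h'' := fun e => hch''0 (e ▸ hk''0)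
  have hchch'' : c * h ≠ c * h'' := fun e => hhh'' (mul_left_cancel e)
  -- the exchanged frame `(T₁; T₀)`
  have hbase₁ := base_cases_exchange c hbase hQ
  have hn₁ : T₁.1.card = 4 * m := card_frame c hc2 T₀ T₁ m hn
  have hH₁ : (T₁.1 \ T₀.1).card = 2 * m := by rw [card_sdiff_frame c hc2 T₀ T₁, hH]
  have hcover₁ := cover_frame c hc2 T₀ L Q hcover
  simp only [hQ] at hcover₁
  -- `D_{T₁}(Φ) = {k, k''} ∪ {c·h, c·h''}`
  have hD1 : T₁.1 \ Φ.1 = {k, k''} ∪ {c * h, c * h''} := by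
    rw [sdiff_T₁_pair_type c hc2 T₀ T₁ T A hTH hA Φ hΦ, hAe, hHe, image_insert, image_singleton]
  -- (b) the mixed pair `Φ^{(k)(h)}`: unique nearest base change `T₁`
  have eH : oflipCM c hc2 h Φ = oflipCM c hc2 (c * h) Φ := (oflipCM_cmul c hc2 h Φ).symm
  have hDh : T₁.1 \ (oflipCM c hc2 h Φ).1 = (T₁.1 \ Φ.1).erase (c * h) := by rw [eH, dev_oflip c hc2 hch1 hchΦ]
  have hkYh : k ∉ (oflipCM c hc2 h Φ).1 := by
    have h0 : k ∈ T₁.1 \ (oflipCM c hc2 h Φ).1 := by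
      rw [hDh, mem_erase, hD1]; exact ⟨hkch, mem_union_left _ (mem_insert_self _ _)⟩
    exact (mem_sdiff.mp h0).2
  have hDkh : T₁.1 \ (oflipCM c hc2 k (oflipCM c hc2 h Φ)).1 ⊆ {k'', c * h''} := by
    rw [dev_oflip c hc2 hk1 hkYh, hDh, hD1]
    intro x hx
    simp only [mem_erase, mem_union, mem_insert, mem_singleton] at hx
    obtain ⟨hxk, hxch, (rfl | rfl) | rfl | rfl⟩ := hx
    · exact absurd rfl hxk
    · exact mem_insert_self _ _
    · exact absurd rfl hxch
    · exact mem_insert_of_mem (mem_singleton_self _)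
  have hb : Finsupp.single (oflipCM c hc2 k (oflipCM c hc2 h Φ)) 1 -
      thetaG c hc2 T₁ (typeSum G c (Finsupp.single (oflipCM c hc2 k (oflipCM c hc2 h Φ)) 1)) ∈ L :=
    single_sub_thetaG_mem_mixed_pair c hc2 hcen T₁ T₀ hbase₁ m hn₁ hH₁ L hcover₁ hm2 hk''1 hch''1 hk''ch'' (iff_of_true hk''0 hch''0) _ hDkh
  -- (c) the tie corner `Φ^{(k)}` with its prescribed face toward `T₁`
  have hX : T₁.1 \ (oflipCM c hc2 k Φ).1 = {k'', c * h, c * h''} := by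
    rw [dev_oflip c hc2 hk1 hkΦ, hD1]
    ext x
    simp only [mem_erase, mem_union, mem_insert, mem_singleton]
    constructor
    · rintro ⟨hxk, (rfl | rfl) | rfl | rfl⟩
      · exact absurd rfl hxk
      · exact Or.inl rfl
      · exact Or.inr (Or.inl rfl)
      · exact Or.inr (Or.inr rfl)
    · rintro (rfl | rfl | rfl)
      · exact ⟨hkk''.symm, Or.inl (Or.inr rfl)⟩
      · exact ⟨hkch.symm, Or.inr (Or.inl rfl)⟩
      · exact ⟨hkch''.symm, Or.inr (Or.inr rfl)⟩
  have hface : gface c hc2 (oflipCM c hc2 k Φ) (c * h) (c * h'') ∈ L := by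
    have e : gface c hc2 (oflipCM c hc2 k Φ) (c * h) (c * h'') = gface c hc2 (oflipCM c hc2 k Φ) h h'' := by
      unfold gface; simp only [oflipCM_cmul]
    rw [e]; exact hFk
  have hc' : Finsupp.single (oflipCM c hc2 k Φ) 1 - thetaG c hc2 T₁ (typeSum G c (Finsupp.single (oflipCM c hc2 k Φ) 1)) ∈ L :=
    single_sub_thetaG_mem_tie_corner c hc2 hcen T₁ T₀ hbase₁ m hn₁ hH₁ L hcover₁ hm2 hk''1 hch1 hch''1 hchch''
      (iff_of_true hk''0 hch0) (iff_of_true hk''0 hch''0) _ hX hface _ (by rw [hX]) (fun _ => by rw [hX]; simp)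
  -- (d) the tie corner `Φ^{(h)}` with its prescribed face toward `T̄₀`, through the complement `c·Φ^{(h)}` (shape A toward `T₀`)
  have hXc := dev_compl_oflipCM_pair_type c hc2 hcen T₀ T₁ T A hTH hA Φ hΦ hHe hhh'' hAce
  have hcinv : c⁻¹ = c := inv_eq_of_mul_eq_one_right hc2
  have hface' : gface c hc2 (rt c c (oflipCM c hc2 h Φ)) k' k''' ∈ L := by
    have h1 := hLrt c _ hFh
    rw [mapDomain_rt_gface, hcinv, hcen k', hcen k'''] at h1
    have e : gface c hc2 (rt c c (oflipCM c hc2 h Φ)) (c * k') (c * k''') = gface c hc2 (rt c c (oflipCM c hc2 h Φ)) k' k''' := by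
      unfold gface; simp only [oflipCM_cmul]
    rw [← e]; exact h1
  have hd0 : Finsupp.single (rt c c (oflipCM c hc2 h Φ)) 1 -
      thetaG c hc2 T₀ (typeSum G c (Finsupp.single (rt c c (oflipCM c hc2 h Φ)) 1)) ∈ L :=
    single_sub_thetaG_mem_tie_corner c hc2 hcen T₀ T₁ hbase m hn hH L hcover hm2 hh''0 hk'0 hk'''0 hk'k'''
      (iff_of_false hh''1 (not_not.mpr hk'1)) (iff_of_false hh''1 (not_not.mpr hk'''1)) _ hXc hface' _ (by rw [hXc])
      (fun _ => by rw [hXc]; simp)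
  have hd : Finsupp.single (oflipCM c hc2 h Φ) 1 -
      thetaG c hc2 (rt c c T₀) (typeSum G c (Finsupp.single (oflipCM c hc2 h Φ) 1)) ∈ L := by
    have h1 := hLrt c _ hd0
    rw [Finsupp.mapDomain_sub, Finsupp.mapDomain_single, mapDomain_rt_thetaG, ← rt_mul, hc2, rt_one] at h1
    exact h1
  -- (e) assemble: the face identity and `typeSum (face) = 0`
  have hnot : h ∉ orb c k := by
    rw [mem_orb]
    rintro (rfl | rfl)
    · exact hh1 hk1
    · exact hch0 (by rw [← mul_assoc, hc2, one_mul]; exact hk0)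
  have hθ : thetaG c hc2 T₁ (typeSum G c (gface c hc2 Φ k h)) = 0 := by rw [typeSum_gface c hc2 Φ hnot, map_zero]
  have e : Finsupp.single Φ 1 - thetaG c hc2 T₁ (typeSum G c (Finsupp.single Φ 1)) -
      (thetaG c hc2 (rt c c T₀) (typeSum G c (Finsupp.single (oflipCM c hc2 h Φ) 1)) -
        thetaG c hc2 T₁ (typeSum G c (Finsupp.single (oflipCM c hc2 h Φ) 1))) =
      gface c hc2 Φ k h -
        (Finsupp.single (oflipCM c hc2 k (oflipCM c hc2 h Φ)) 1 -
          thetaG c hc2 T₁ (typeSum G c (Finsupp.single (oflipCM c hc2 k (oflipCM c hc2 h Φ)) 1))) +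
        (Finsupp.single (oflipCM c hc2 k Φ) 1 - thetaG c hc2 T₁ (typeSum G c (Finsupp.single (oflipCM c hc2 k Φ) 1))) +
        (Finsupp.single (oflipCM c hc2 h Φ) 1 - thetaG c hc2 (rt c c T₀) (typeSum G c (Finsupp.single (oflipCM c hc2 h Φ) 1))) -
        thetaG c hc2 T₁ (typeSum G c (gface c hc2 Φ k h)) := by
    simp only [gface, map_add, map_sub]; abel
  rw [e, hθ, sub_zero]
  exact Submodule.add_mem _ (Submodule.add_mem _ (Submodule.sub_mem _ hF hb) hc') hd

/-! ## §3 The stabiliser relation of the designated type -/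

include hcen hbase hn hH hQ hLrt hcover in
/-- **THE STABILISER RELATION OF THE DESIGNATED TYPE** (`m = 2`; the one new near relation of the order-`4` rows).  In the situation of
`defect_T₁_mixed_face`, let `g₁` stabilise `T₀` and `Φ` and carry `T₁` to `T̄₁` (`T₀·g₁⁻¹ = T₀`, `T₁·g₁⁻¹ = T̄₁`, `Φ·g₁⁻¹ = Φ`).  Then the near vector
`(θ_{T̄₁} − θ_{T₁})(typeSum [Φ]) − (θ_{T̄₀} − θ_{T₁})(typeSum [Φ^{(h)}]) + (θ_{T̄₀} − θ_{T̄₁})(typeSum [Φ^{(h·g₁⁻¹)}])` lies in `L`: the `T₁`-defect of `Φ`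
minus its translate by `g₁` (the `T̄₁`-defect of `Φ·g₁⁻¹ = Φ`). [folklore] -/
theorem mixed_face_stabiliser_relation (hm : m = 2) (T A : Finset G) (hTH : T ⊆ T₀.1 \ T₁.1) (hA : A ⊆ T₀.1 ∩ T₁.1)
    (Φ : CMF G c) (hΦ : T₀.1 \ Φ.1 = T ∪ A)
    {k k'' : G} (hAe : A = {k, k''}) (hkk'' : k ≠ k'')
    {h h'' : G} (hHe : (T₀.1 \ T₁.1) \ T = {h, h''}) (hhh'' : h ≠ h'')
    {k' k''' : G} (hAce : (T₀.1 ∩ T₁.1) \ A = {k', k'''}) (hk'k''' : k' ≠ k''')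
    (hF : gface c hc2 Φ k h ∈ L) (hFk : gface c hc2 (oflipCM c hc2 k Φ) h h'' ∈ L)
    (hFh : gface c hc2 (oflipCM c hc2 h Φ) k' k''' ∈ L)
    (g₁ : G) (hg₀ : rt c g₁ T₀ = T₀) (hg₁ : rt c g₁ T₁ = rt c c T₁) (hgΦ : rt c g₁ Φ = Φ) :
    (thetaG c hc2 (rt c c T₁) (typeSum G c (Finsupp.single Φ 1)) - thetaG c hc2 T₁ (typeSum G c (Finsupp.single Φ 1))) -
      (thetaG c hc2 (rt c c T₀) (typeSum G c (Finsupp.single (oflipCM c hc2 h Φ) 1)) -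
        thetaG c hc2 T₁ (typeSum G c (Finsupp.single (oflipCM c hc2 h Φ) 1))) +
      (thetaG c hc2 (rt c c T₀) (typeSum G c (Finsupp.single (oflipCM c hc2 (h * g₁⁻¹) Φ) 1)) -
        thetaG c hc2 (rt c c T₁) (typeSum G c (Finsupp.single (oflipCM c hc2 (h * g₁⁻¹) Φ) 1))) ∈ L := by
  have hv := defect_T₁_mixed_face c hc2 hcen T₀ T₁ hbase m hn hH Q hQ L hLrt hcover hm T A hTH hA Φ hΦ hAe hkk'' hHe hhh'' hAce hk'k''' hF hFk hFh
  have hgc : rt c g₁ (rt c c T₀) = rt c c T₀ := by rw [← rt_mul, hcen g₁, rt_mul, hg₀]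
  have hw := hLrt g₁ _ hv
  simp only [Finsupp.mapDomain_sub, Finsupp.mapDomain_single, mapDomain_rt_thetaG, rt_oflipCM, hgΦ, hg₁, hgc] at hw
  have e : (thetaG c hc2 (rt c c T₁) (typeSum G c (Finsupp.single Φ 1)) - thetaG c hc2 T₁ (typeSum G c (Finsupp.single Φ 1))) -
      (thetaG c hc2 (rt c c T₀) (typeSum G c (Finsupp.single (oflipCM c hc2 h Φ) 1)) -
        thetaG c hc2 T₁ (typeSum G c (Finsupp.single (oflipCM c hc2 h Φ) 1))) +
      (thetaG c hc2 (rt c c T₀) (typeSum G c (Finsupp.single (oflipCM c hc2 (h * g₁⁻¹) Φ) 1)) -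
        thetaG c hc2 (rt c c T₁) (typeSum G c (Finsupp.single (oflipCM c hc2 (h * g₁⁻¹) Φ) 1))) =
      (Finsupp.single Φ 1 - thetaG c hc2 T₁ (typeSum G c (Finsupp.single Φ 1)) -
        (thetaG c hc2 (rt c c T₀) (typeSum G c (Finsupp.single (oflipCM c hc2 h Φ) 1)) -
          thetaG c hc2 T₁ (typeSum G c (Finsupp.single (oflipCM c hc2 h Φ) 1)))) -
      (Finsupp.single Φ 1 - thetaG c hc2 (rt c c T₁) (typeSum G c (Finsupp.single Φ 1)) -
        (thetaG c hc2 (rt c c T₀) (typeSum G c (Finsupp.single (oflipCM c hc2 (h * g₁⁻¹) Φ) 1)) -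
          thetaG c hc2 (rt c c T₁) (typeSum G c (Finsupp.single (oflipCM c hc2 (h * g₁⁻¹) Φ) 1)))) := by
    abel
  rw [e]
  exact Submodule.sub_mem _ hv hw

end Frame

end

end Summit.HodgeConjecture.CorCM.Census.CentralSquares
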